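import Literature.MathematicalPhysics.QuantumFieldTheory.Balaban1983to89.T3MinimiserStabilityReduction
import Literature.MathematicalPhysics.QuantumFieldTheory.Balaban1983to89.T3PrintedRegularMinimiser
import Literature.MathematicalPhysics.QuantumFieldTheory.Balaban1983to89.T3OrbitAverage
import Literature.MathematicalPhysics.QuantumFieldTheory.Balaban1983to89.B12ContinuousTransportInvariance
import Literature.MathematicalPhysics.QuantumFieldTheory.Balaban1983to89.Node00.CanonicalTransportOfRecord
import Literature.MathematicalPhysics.QuantumFieldTheory.Balaban1983to89.TreeLengthTorusTwoPoint
import Summits.QuantumFields.YangMills.Theorems.FluctuationComparisonRegPrIntLPolymerMayerGasParam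
import HarnessLib

/-!
# LINE g24-4 «background form» v2 — THE GAS KNIT: analytic cube-polymer terms ⊕ a Kotecký–Preiss gas IN THE BACKGROUND REGISTERS ⟹ BGFORMᵃ∘ v2 (texts inline, def-free)

Cell `ym3-torus` (YM ladder rung R3 = continuum `SU(2)` Yang–Mills on the three-torus — a RUNG, NOT d = 4, NOT infinite volume, NOT a mass gap, NOT Clay).  Width seat
`ym-ust-20520-w3` (gen 21, LEAD-20520 by lineage); `--supports stmt-QuantumFields-20520 --as helper`, count-neutral, definition-free, default heartbeats.
CONE (LINE g24-4 v2, ideator ym-r3-idea-1 g24; registry `Lines/semiclassical_s2beta.lean` v11.4 FROZEN 0∕5, nothing here is registered): ⟨GASᵇᵍ∘ v2⟩ →(THIS FILE)→ ⟨BGFORMᵃ∘ v2⟩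
→(w5 g20 (K⁗ᵛ²))→ ⟨BGFORM∘ v2 = TREE `Lines/background_form.lean` 22880983⟩ →(w4 g20 (Hᵛ²))→ {S2β `FluctuationPartSmall` :412, GRAD∘}.

HYPOTHESIS GASᵇᵍ∘ v2 (binder `hG`; the LEAD's cut — the ideator may re-letter): BGFORMᵃ∘ v2's (w5 g20, v1.1 text 221b2a5fa5f0aca3) frame, `c₀ d blk M`, (d1)–(d5), (r1)∕(r2), `σ σ₂`
BYTE-VERBATIM; its cell-term block `(𝒯, Dom, Bx)` REPLACED by print-shaped data on the GLOBAL complexified register space `PBond (F.P K) 0 → (Fin 8 → ℂ)`: uniform constants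
`(κ μ C As Ag R r₁ Rₐ) (Mc) (_ : NeZero Mc)` in the d = 3 regime `2κ₀(4·2³,2·3) ≤ r₁`, `r₁ + 2κ₀ + 2 ≤ R`, `Ag·e^{5r₁+1}·K₀(4·2³,2·3)·7·32 ≤ 1` ([Balaban1988RG2Cluster] (1.26), (2.11));
per `(J, K, ρ)` a cube torus `TPt 3 Ncb` with `ecb : PBond (F.P J) 0 → TPt 3 (Ncb·Mc)` (cube map `tcubeOf Ncb Mc ∘ ecb`, [Balaban1987RG1] §0 p.257), a PRODUCT DOMAIN
`D : PBond (F.P K) 0 → Set (Fin 8 → ℂ)` (each open, containing the `2Rₐ`-ball about the real registers `M U e ↪ ℂ⁸` of window fields — (1.11)–(1.14) p.262 are per-variable),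
ANALYTIC CUBE-POLYMER TERMS `𝒮 Y` (local through `tcubeOf ∘ ecb ∘ blk`, supported on face-connected `Y`, `DifferentiableOn ℂ` on `Π_e D e`, `≤ As·e^{−r₁·torusTreeLen Y}` there —
re-localized `E^{(j)}(Y,·)` of (0.22)–(0.25) pp.256–257, one scale per [Balaban1988RG2Cluster] (2.29), ANALYTIC IN THE BACKGROUND), a KOTECKÝ–PREISS GAS `act Z` of face-connected
cube polymers with the `TTouch` hard core (local likewise, `DifferentiableOn ℂ` on `Π_e D e`, `≤ Ag·e^{−R·torusTreeLen Z}`, REAL at real registers — the large-field strata BEFORE the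
last Mayer logarithm, [Balaban1989LargeFieldII] (1.98)–(1.100) p.390), the two-pin coupling (d6) `2μ·d c c' ≤ (r₁∕2∕(Mc·3))·pl1 (ecb c − ecb c')`, and the REPRESENTATION
`log ρ U + β_K·𝔄^reg U = c₀ + Σ_Y Re 𝒮 Y (M U ↪ ℂ⁸) + Real.log (Re Ξ(act · (M U ↪ ℂ⁸)))` on the window.

THE KNIT ★★★ `backgroundFormCellAnalytic_of_gas : ⟨GASᵇᵍ∘ v2⟩ → ⟨BGFORMᵃ∘ v2 VERBATIM⟩`.  For a cell `X` with register space `P_X := ({e ∕∕ blk e ∈ X} → (Fin 8 → ℂ))`: GLUE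
`ext_X : P_X → (PBond (F.P K) 0 → (Fin 8 → ℂ))` (registers of `X`'s blocks, a base point of `D e` elsewhere; §1), `Dom X := ext_X⁻¹(Π_e D e)`,
`𝒯 X p := Σ_{Y : bs Y = X} (𝒮 Y (ext_X p) + E_{act(ext_X p)}(Y))` (`bs Y` = coarse bonds whose cube lies in `Y`; `E` = lit ✓`B13Resummation.locE`),
`Bx X := Σ_{Y : bs Y = X, face-connected} (As + e·7·32·K₀²·Ag)·e^{−r₁·torusTreeLen Y}`, `A := (As + CE·Ag)·K₀`, `Hc := (As + CE·Ag)·e^{3r₁∕2}·K₀`; `κ μ C Rₐ σ σ₂ c₀ d blk M` unchanged.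
Proof: holomorphy ∕ (2.41) envelope ∕ support ∕ realness of the gas terms = ✓`…PolymerMayerGasParam` (p776630) at parameter space `P_X` (activity field `p ↦ act · (ext_X p)`) resp. the
global register space; one-∕two-pin sums = lit ✓`sum_exp_torusTreeLen_le` ∕ ✓`sum_exp_torusTreeLen_two_sites_le` ((1.26) at one ∕ two marked cubes) after the fibrewise regrouping
`Σ_{X ∋ c} Σ_{Y : bs Y = X} = Σ_{Y ∋ cube c}` and (d6); collar by `dist_le_pi_dist`; representation by LOCALITY (each term of the fibre of `X` reads `ext_X (M U|_X ↪ ℂ⁸)` only on `X`'s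
blocks, where it IS `M U ↪ ℂ⁸`), `Finset.sum_fiberwise` and ✓`locE_param_real`.  VALUE: after this file the v2 cone asks of print ONLY per-polymer analytic data + a KP gas in background
variables + the response rows (r1)∕(r2) ([Balaban1985Variational] Prop. 9 ∕ (190)); Mayer step, (2.41), lattice-animal resummations, cell dictionary and glue are discharged.
HONEST: GASᵇᵍ∘ v2 is a HYPOTHESIS SCHEMA (docking row, «any maps»); (resp1)∕uniform-`C` is SUSPENDED (idea-crit-5 #496b) and this file claims nothing about it; nothing of Bałaban's
is asserted; BGFORMᵃ∘ v2 ∕ BGFORM∘ v2 ∕ S2β ∕ GRAD∘ ∕ the five registered ∘-stubs ∕ `FluctuationComparisonRegPrIntL` (20520) ∕ `YM3TorusSU2` NOT proved.  Sorry-free, axioms standard.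
References: [Balaban1988RG2Cluster] CMP **116** (1988) 1–22; [Balaban1987RG1] CMP **109** (1987) 249–301; [Balaban1989LargeFieldII] CMP **122** (1989) 355–392; [Balaban1985Variational]
CMP **102** (1985) 277–309; [KoteckyPreiss1986] CMP **103** (1986) 491–498.
-/

set_option autoImplicit false

noncomputable section

namespace Summit.QuantumFields.YangMills.Theorems.FluctuationComparisonRegPrIntLBackgroundFormCellGasKnit

open MeasureTheory Filter Topology Set
open scoped BigOperators
open Literature.MathematicalPhysics.QuantumFieldTheory.Balaban1983to89
open Literature.MathematicalPhysics.QuantumFieldTheory.Balaban1983to89.T3ContinuumYM3Torus T3NestedUnitLaws T3UnitLawDensityEML T3UnitScaleTilt T3TiltDescent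
  T3PrintedRegularMinimiser T3LevelShift Missing T4Continuum
open Literature.MathematicalPhysics.QuantumFieldTheory.Balaban1983to89.TreeLengthTorus (TPt TDom IsTDom tsys TFaceConnected torusTreeLen torusTreeLen_nonneg sum_exp_torusTreeLen_le sum_exp_torusTreeLen_two_sites_le)
open Literature.MathematicalPhysics.QuantumFieldTheory.Balaban1983to89.TreeLengthTorusGeometry (TTouch tgeometry ttouch_refl ttouch_symm tgeometry_consts)
open Literature.MathematicalPhysics.QuantumFieldTheory.Balaban1983to89.B12TreeDecay (kappa₀ K₀ kappa₀_nonneg K₀_pos)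
open Literature.MathematicalPhysics.QuantumFieldTheory.Balaban1983to89.B12Decay510Torus (pl1 tcubeOf)
open Literature.MathematicalPhysics.QuantumFieldTheory.Balaban1983to89.B13Resummation (locE locE_congr)
open Literature.Probability.LatticeModels
open Summit.QuantumFields.YangMills.Theorems.FluctuationComparisonRegPrIntLPolymerMayerGas
open Summit.QuantumFields.YangMills.Theorems.FluctuationComparisonRegPrIntLPolymerMayerGasParam


/-! ## §1 The register glue: registers of the blocks of a coarse cell, extended by a base point -/

section Ext

variable {α β : Type*} [Fintype α] [DecidableEq β] {V : Type*} [NormedAddCommGroup V] [NormedSpace ℂ V]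

/-- The extension of a register configuration on the blocks of a cell `X` by a fixed base configuration off the blocks is a complex-differentiable (affine) map into the
global register space. [folklore] -/
theorem differentiable_cellExt (blk : α → β) (X : Finset β) (base : α → V) :
    Differentiable ℂ (fun (p : {a : α // blk a ∈ X} → V) (a : α) => if h : blk a ∈ X then p ⟨a, h⟩ else base a) := by
  refine differentiable_pi.2 fun a => ?_
  by_cases h : blk a ∈ X
  · simp only [dif_pos h]
    exact (ContinuousLinearMap.proj (R := ℂ) (φ := fun _ : {a : α // blk a ∈ X} => V) ⟨a, h⟩).differentiable
  · simp only [dif_neg h]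
    exact differentiable_const _

omit [NormedSpace ℂ V] in
/-- The preimage of a product of open sets under the cell extension is open. [folklore] -/
theorem isOpen_cellDom (blk : α → β) (X : Finset β) (base : α → V) (D : α → Set V) (hD : ∀ a, IsOpen (D a)) :
    IsOpen {p : {a : α // blk a ∈ X} → V | ∀ a, (if h : blk a ∈ X then p ⟨a, h⟩ else base a) ∈ D a} := by
  rw [Set.setOf_forall]
  refine isOpen_iInter_of_finite fun a => ?_
  by_cases h : blk a ∈ X
  · simp only [dif_pos h]
    exact (hD a).preimage (continuous_apply (⟨a, h⟩ : {a : α // blk a ∈ X}))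
  · simp only [dif_neg h]
    by_cases hb : base a ∈ D a
    · simp only [hb, Set.setOf_true]; exact isOpen_univ
    · simp only [hb, Set.setOf_false]; exact isOpen_empty

end Ext

/-! ## §2 THE KNIT: GASᵇᵍ∘ v2 → BGFORMᵃ∘ v2 -/

open Classical in
/-- ★★★ **GASᵇᵍ∘ v2 → BGFORMᵃ∘ v2** (hypothesis = the LEAD's cut GASᵇᵍ∘ v2, text above; conclusion = w5-20520 g20's BGFORMᵃ∘ v2 v1.1 text 221b2a5fa5f0aca3 VERBATIM).
Witnesses: `𝒯 X p := Σ_{Y : bs Y = X} (𝒮 Y + E_{act}(Y)) (ext_X p)` (`bs Y` = the coarse bonds whose `Mc`-cube lies in `Y`, `ext_X` = §1's glue with a base point of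
`Π_e D e`), `Dom X := ext_X⁻¹(Π_e D e)`, `Bx X := Σ_{Y : bs Y = X, face-connected} (As + e·7·32·K₀(32,6)²·Ag)·e^{−r₁·torusTreeLen Y}`, constants
`A := (As + CE·Ag)·K₀(32,6)`, `Hc := (As + CE·Ag)·e^{3r₁∕2}·K₀(32,6)`, `κ μ C Rₐ σ σ₂ c₀ d blk M` unchanged.  Holomorphy ∕ envelope ∕ support ∕ realness of the gas terms
by ✓`…PolymerMayerGasParam` at parameter space `({e ∕∕ blk e ∈ X} → (Fin 8 → ℂ))` resp. the global register space; pins by lit (1.26) at one ∕ two marked cubes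
(✓`TreeLengthTorus.sum_exp_torusTreeLen_le`, ✓`sum_exp_torusTreeLen_two_sites_le`) and (d6); representation by `Finset.sum_fiberwise` + locality + ✓`locE_param_real`.
[cite: Balaban1988RG2Cluster, (1.26) p.8, (2.11)-(2.13) p.14, (2.29) p.18, (2.41) p.21; Balaban1987RG1, (0.22)-(0.25) pp.256-257 and (1.11)-(1.14) p.262; Balaban1989LargeFieldII, (1.98)-(1.100) p.390; Balaban1985Variational, Prop. 9 p.309; KoteckyPreiss1986, Theorem p.492] -/
theorem backgroundFormCellAnalytic_of_gas
    (hG :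
      ∀ (L : ℕ), ∃ pS : ℝ, ∀ (b₀ p₀ : ℝ), 0 < b₀ → pS ≤ p₀ → 0 < p₀ → ∃ ε₁ : ℝ, 0 < ε₁ ∧ ∀ (ε₀ : ℝ), 0 < ε₀ → ε₀ ≤ ε₁ →
        ∃ γ₁ : ℝ, 0 < γ₁ ∧ ∃ (κ μ C As Ag R r₁ Rₐ : ℝ) (Mc : ℕ) (_ : NeZero Mc), 0 < κ ∧ 0 ≤ μ ∧ 0 ≤ As ∧ 0 ≤ Ag ∧ 0 < Rₐ ∧
          2 * kappa₀ (4 * 2 ^ 3) (2 * 3) ≤ r₁ ∧ r₁ + 2 * kappa₀ (4 * 2 ^ 3) (2 * 3) + 2 ≤ R ∧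
          Ag * Real.exp (5 * r₁ + 1) * K₀ (4 * 2 ^ 3) (2 * 3) * 7 * 32 ≤ 1 ∧ ∀ (F : T3Family) (γ : ℝ), F.L = L → 0 < γ → γ ≤ γ₁ →
          ∃ (σ σ₂ : ℕ → ℝ), (∀ J, 0 ≤ σ J) ∧ (∀ J, 0 ≤ σ₂ J) ∧
            (∀ a : ℕ, Tendsto (fun J : ℕ => ((J : ℝ) + 1) ^ a * σ J) atTop (𝓝 0)) ∧
            (∀ a : ℕ, Tendsto (fun J : ℕ => ((J : ℝ) + 1) ^ a * σ₂ J) atTop (𝓝 0)) ∧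
            ∀ (ν : ℕ → (j : ℕ) → Measure (GaugeField (F.P j) 0 (Matrix.specialUnitaryGroup (Fin 2) ℂ))),
              (∀ K, ν K K = T4GenFunBounds.gibbsMeasure (F.P K) ((F.scheme ℰp γ).β K)) →
              (∀ K j, j < K → ν K j = Measure.map (descend F ℰp j) (ν K (j + 1))) →
              ∀ (J K : ℕ) (hJK : J ≤ K) (ρ : GaugeField (F.P J) 0 (Matrix.specialUnitaryGroup (Fin 2) ℂ) → ℝ),
                (∀ U, PlaqSmall (θBal F.L γ b₀ p₀ J) U → 0 < ρ U) →
                ν K J = (fieldMeasure _ _ _).withDensity (fun U => ENNReal.ofReal (ρ U)) →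
                ContinuousOn ρ {U | PlaqSmall (θBal F.L γ b₀ p₀ J) U} →
                ∃ (c₀ : ℝ) (d : PBond (F.P J) 0 → PBond (F.P J) 0 → ℝ) (blk : PBond (F.P K) 0 → PBond (F.P J) 0)
                  (M : GaugeField (F.P J) 0 (Matrix.specialUnitaryGroup (Fin 2) ℂ) → PBond (F.P K) 0 → (Fin 8 → ℝ))
                  (Ncb : ℕ) (_ : NeZero Ncb) (ecb : PBond (F.P J) 0 → TPt 3 (Ncb * Mc))
                  (D : PBond (F.P K) 0 → Set (Fin 8 → ℂ))
                  (𝒮 : Finset (TPt 3 Ncb) → (PBond (F.P K) 0 → (Fin 8 → ℂ)) → ℂ)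
                  (act : TDom 3 Ncb → (PBond (F.P K) 0 → (Fin 8 → ℂ)) → ℂ),
                  (∀ x y, 0 ≤ d x y) ∧ (∀ x y, d x y = d y x) ∧ (∀ x y z, d x z ≤ d x y + d y z) ∧
                  (∀ x, ∑ y, Real.exp (-(μ * d x y)) ≤ C) ∧
                  (∀ b b' : PBond (F.P J) 0, κ * (b.src.tdist b'.src : ℝ) ≤ μ * d b b') ∧
                  (∀ c c' : PBond (F.P J) 0, 2 * μ * d c c' ≤ (r₁ / 2 / ((Mc : ℝ) * 3)) * pl1 (ecb c - ecb c')) ∧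
                  (∀ e, IsOpen (D e)) ∧
                  (∀ (U : GaugeField (F.P J) 0 (Matrix.specialUnitaryGroup (Fin 2) ℂ)), PlaqSmall (θBal F.L γ b₀ p₀ J) U →
                      ∀ e, Metric.ball (fun (i : Fin 8) => (M U e i : ℂ)) (2 * Rₐ) ⊆ D e) ∧
                  (∀ (Y : Finset (TPt 3 Ncb)) (q q' : PBond (F.P K) 0 → (Fin 8 → ℂ)),
                      (∀ e, tcubeOf Ncb Mc (ecb (blk e)) ∈ Y → q e = q' e) → 𝒮 Y q = 𝒮 Y q') ∧
                  (∀ Y : Finset (TPt 3 Ncb), ¬ TFaceConnected Y → ∀ q, 𝒮 Y q = 0) ∧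
                  (∀ Y, DifferentiableOn ℂ (𝒮 Y) {q | ∀ e, q e ∈ D e}) ∧
                  (∀ Y, ∀ q ∈ {q : PBond (F.P K) 0 → (Fin 8 → ℂ) | ∀ e, q e ∈ D e}, ‖𝒮 Y q‖ ≤ As * Real.exp (-r₁ * torusTreeLen Y)) ∧
                  (∀ (Z : TDom 3 Ncb) (q q' : PBond (F.P K) 0 → (Fin 8 → ℂ)),
                      (∀ e, tcubeOf Ncb Mc (ecb (blk e)) ∈ Z.1 → q e = q' e) → act Z q = act Z q') ∧
                  (∀ Z, DifferentiableOn ℂ (act Z) {q | ∀ e, q e ∈ D e}) ∧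
                  (∀ Z, ∀ q ∈ {q : PBond (F.P K) 0 → (Fin 8 → ℂ) | ∀ e, q e ∈ D e}, ‖act Z q‖ ≤ Ag * Real.exp (-(R * torusTreeLen Z.1))) ∧
                  (∀ (U : GaugeField (F.P J) 0 (Matrix.specialUnitaryGroup (Fin 2) ℂ)), PlaqSmall (θBal F.L γ b₀ p₀ J) U →
                      ∀ Z, (act Z (fun e (i : Fin 8) => (M U e i : ℂ))).im = 0) ∧
                  (∀ (b : PBond (F.P J) 0) (U V : GaugeField (F.P J) 0 (Matrix.specialUnitaryGroup (Fin 2) ℂ)),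
                      PlaqSmall (θBal F.L γ b₀ p₀ J) U → PlaqSmall (θBal F.L γ b₀ p₀ J) V → (∀ e, e ≠ b → U e = V e) →
                      ∀ e, ‖M U e - M V e‖ ≤ σ J * Real.exp (-(2 * μ * d b (blk e)))) ∧
                  (∀ (b b' : PBond (F.P J) 0) (U V W Z : GaugeField (F.P J) 0 (Matrix.specialUnitaryGroup (Fin 2) ℂ)),
                      PlaqSmall (θBal F.L γ b₀ p₀ J) U → PlaqSmall (θBal F.L γ b₀ p₀ J) V →
                      PlaqSmall (θBal F.L γ b₀ p₀ J) W → PlaqSmall (θBal F.L γ b₀ p₀ J) Z →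
                      (∀ e, e ≠ b → U e = V e) → (∀ e, e ≠ b' → U e = W e) → (∀ e, e ≠ b' → V e = Z e) → (∀ e, e ≠ b → W e = Z e) →
                      ∀ e, ‖M U e - M W e - M V e + M Z e‖ ≤
                        σ₂ J * (Real.exp (-(2 * μ * d b (blk e))) * Real.exp (-(2 * μ * d (blk e) b')))) ∧
                  (∀ U : GaugeField (F.P J) 0 (Matrix.specialUnitaryGroup (Fin 2) ℂ), PlaqSmall (θBal F.L γ b₀ p₀ J) U →
                      Real.log (ρ U) + (F.scheme ℰp γ).β K * minActionRegPr F J K hJK ε₀ U =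
                        c₀ + ∑ Y, (𝒮 Y (fun e (i : Fin 8) => (M U e i : ℂ))).re +
                          Real.log (polymerPartitionFunction TTouch (fun Z : TDom 3 Ncb => act Z (fun e (i : Fin 8) => (M U e i : ℂ))) Finset.univ).re)) :
    ∀ (L : ℕ), ∃ pS : ℝ, ∀ (b₀ p₀ : ℝ), 0 < b₀ → pS ≤ p₀ → 0 < p₀ → ∃ ε₁ : ℝ, 0 < ε₁ ∧ ∀ (ε₀ : ℝ), 0 < ε₀ → ε₀ ≤ ε₁ →
      ∃ γ₁ : ℝ, 0 < γ₁ ∧ ∃ (κ μ C A Hc Rₐ : ℝ), 0 < κ ∧ 0 ≤ μ ∧ 0 ≤ A ∧ 0 ≤ Hc ∧ 0 < Rₐ ∧ ∀ (F : T3Family) (γ : ℝ), F.L = L → 0 < γ → γ ≤ γ₁ →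
        ∃ (σ σ₂ : ℕ → ℝ), (∀ J, 0 ≤ σ J) ∧ (∀ J, 0 ≤ σ₂ J) ∧
          (∀ a : ℕ, Tendsto (fun J : ℕ => ((J : ℝ) + 1) ^ a * σ J) atTop (𝓝 0)) ∧
          (∀ a : ℕ, Tendsto (fun J : ℕ => ((J : ℝ) + 1) ^ a * σ₂ J) atTop (𝓝 0)) ∧
          ∀ (ν : ℕ → (j : ℕ) → Measure (GaugeField (F.P j) 0 (Matrix.specialUnitaryGroup (Fin 2) ℂ))),
            (∀ K, ν K K = T4GenFunBounds.gibbsMeasure (F.P K) ((F.scheme ℰp γ).β K)) →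
            (∀ K j, j < K → ν K j = Measure.map (descend F ℰp j) (ν K (j + 1))) →
            ∀ (J K : ℕ) (hJK : J ≤ K) (ρ : GaugeField (F.P J) 0 (Matrix.specialUnitaryGroup (Fin 2) ℂ) → ℝ),
              (∀ U, PlaqSmall (θBal F.L γ b₀ p₀ J) U → 0 < ρ U) →
              ν K J = (fieldMeasure _ _ _).withDensity (fun U => ENNReal.ofReal (ρ U)) →
              ContinuousOn ρ {U | PlaqSmall (θBal F.L γ b₀ p₀ J) U} →
              ∃ (c₀ : ℝ) (d : PBond (F.P J) 0 → PBond (F.P J) 0 → ℝ) (blk : PBond (F.P K) 0 → PBond (F.P J) 0)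
                (M : GaugeField (F.P J) 0 (Matrix.specialUnitaryGroup (Fin 2) ℂ) → PBond (F.P K) 0 → (Fin 8 → ℝ))
                (𝒯 : (X : Finset (PBond (F.P J) 0)) → (({e : PBond (F.P K) 0 // blk e ∈ X} → (Fin 8 → ℂ)) → ℂ))
                (Dom : (X : Finset (PBond (F.P J) 0)) → Set ({e : PBond (F.P K) 0 // blk e ∈ X} → (Fin 8 → ℂ)))
                (Bx : Finset (PBond (F.P J) 0) → ℝ),
                (∀ x y, 0 ≤ d x y) ∧ (∀ x y, d x y = d y x) ∧ (∀ x y z, d x z ≤ d x y + d y z) ∧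
                (∀ x, ∑ y, Real.exp (-(μ * d x y)) ≤ C) ∧
                (∀ b b' : PBond (F.P J) 0, κ * (b.src.tdist b'.src : ℝ) ≤ μ * d b b') ∧
                (∀ X, 0 ≤ Bx X) ∧
                (∀ c, ∑ X ∈ Finset.univ.filter (fun X => c ∈ X), Bx X ≤ A) ∧
                (∀ c c', ∑ X ∈ Finset.univ.filter (fun X => c ∈ X ∧ c' ∈ X), Bx X ≤ Hc * Real.exp (-(2 * μ * d c c'))) ∧
                (∀ X, IsOpen (Dom X)) ∧ (∀ X, DifferentiableOn ℂ (𝒯 X) (Dom X)) ∧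
                (∀ X, ∀ p ∈ Dom X, ‖𝒯 X p‖ ≤ Bx X) ∧
                (∀ (X : Finset (PBond (F.P J) 0)) (U : GaugeField (F.P J) 0 (Matrix.specialUnitaryGroup (Fin 2) ℂ)),
                    PlaqSmall (θBal F.L γ b₀ p₀ J) U →
                    Metric.ball (fun (e : {e : PBond (F.P K) 0 // blk e ∈ X}) (i : Fin 8) => (M U e.1 i : ℂ)) (2 * Rₐ) ⊆ Dom X) ∧
                (∀ (b : PBond (F.P J) 0) (U V : GaugeField (F.P J) 0 (Matrix.specialUnitaryGroup (Fin 2) ℂ)),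
                    PlaqSmall (θBal F.L γ b₀ p₀ J) U → PlaqSmall (θBal F.L γ b₀ p₀ J) V → (∀ e, e ≠ b → U e = V e) →
                    ∀ e, ‖M U e - M V e‖ ≤ σ J * Real.exp (-(2 * μ * d b (blk e)))) ∧
                (∀ (b b' : PBond (F.P J) 0) (U V W Z : GaugeField (F.P J) 0 (Matrix.specialUnitaryGroup (Fin 2) ℂ)),
                    PlaqSmall (θBal F.L γ b₀ p₀ J) U → PlaqSmall (θBal F.L γ b₀ p₀ J) V →
                    PlaqSmall (θBal F.L γ b₀ p₀ J) W → PlaqSmall (θBal F.L γ b₀ p₀ J) Z →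
                    (∀ e, e ≠ b → U e = V e) → (∀ e, e ≠ b' → U e = W e) → (∀ e, e ≠ b' → V e = Z e) → (∀ e, e ≠ b → W e = Z e) →
                    ∀ e, ‖M U e - M W e - M V e + M Z e‖ ≤
                      σ₂ J * (Real.exp (-(2 * μ * d b (blk e))) * Real.exp (-(2 * μ * d (blk e) b')))) ∧
                (∀ U : GaugeField (F.P J) 0 (Matrix.specialUnitaryGroup (Fin 2) ℂ), PlaqSmall (θBal F.L γ b₀ p₀ J) U →
                    Real.log (ρ U) + (F.scheme ℰp γ).β K * minActionRegPr F J K hJK ε₀ U = c₀ + ∑ X, (𝒯 X (fun (e : {e : PBond (F.P K) 0 // blk e ∈ X}) (i : Fin 8) => (M U e.1 i : ℂ))).re) := by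

  intro L
  obtain ⟨pS, HpS⟩ := hG L
  refine ⟨pS, fun b₀ p₀ hb₀ hpS hp₀ => ?_⟩
  obtain ⟨ε₁, hε₁, Hε⟩ := HpS b₀ p₀ hb₀ hpS hp₀
  refine ⟨ε₁, hε₁, fun ε₀ hε₀ hε₀₁ => ?_⟩
  obtain ⟨γ₁, hγ₁, κ, μ, C, As, Ag, R, r₁, Rₐ, Mc, instMc, hκ, hμ, hAs, hAg, hRₐ, hr₁κ, hrate, hsmall, HF⟩ := Hε ε₀ hε₀ hε₀₁
  -- uniform constants
  have hκ₀0 : 0 ≤ kappa₀ (4 * 2 ^ 3) (2 * 3) := kappa₀_nonneg (by positivity) _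
  have h2R : (0 : ℝ) < 2 * Rₐ := by positivity
  have hr₁0 : 0 ≤ r₁ := by linarith
  have hK₀c : 0 < K₀ (4 * 2 ^ 3) (2 * 3) := K₀_pos _ _
  set CE : ℝ := Real.exp 1 * 7 * 32 * K₀ (4 * 2 ^ 3) (2 * 3) ^ 2 with hCE
  have hCE0 : 0 ≤ CE := by positivity
  set W : ℝ := As + CE * Ag with hW
  have hW0 : 0 ≤ W := by positivity
  refine ⟨γ₁, hγ₁, κ, μ, C, W * K₀ (4 * 2 ^ 3) (2 * 3), W * Real.exp (3 * (r₁ / 2)) * K₀ (4 * 2 ^ 3) (2 * 3), Rₐ,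
    hκ, hμ, by positivity, by positivity, hRₐ, fun F γ hFL hγ hγ₁' => ?_⟩
  obtain ⟨σ, σ₂, hσ0, hσ₂0, hσ, hσ₂, Hν⟩ := HF F γ hFL hγ hγ₁'
  refine ⟨σ, σ₂, hσ0, hσ₂0, hσ, hσ₂, fun ν hνK hνd J K hJK ρ hρpos hρν hρcont => ?_⟩
  obtain ⟨c₀, d, blk, M, Ncb, instN, ecb, D, 𝒮, act, hd0, hdsymm, hdtri, hdC, hdκ, hd6, hDopen, hcollar,
    h𝒮loc, h𝒮supp, h𝒮hol, h𝒮bd, hactloc, hacthol, hactbd, hactreal, hr1, hr2, hrep⟩ :=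
    Hν ν hνK hνd J K hJK ρ hρpos hρν hρcont
  -- the torus-geometry constants in the row's numerals
  have hνc : (tgeometry 3 Ncb).ν = 7 := by rw [(tgeometry_consts 3 Ncb).1]; norm_num
  have hc₁c : (tgeometry 3 Ncb).c₁ = 32 := by rw [(tgeometry_consts 3 Ncb).2.2.2]; norm_num
  have hκ₀c : (tgeometry 3 Ncb).κ₀ = kappa₀ (4 * 2 ^ 3) (2 * 3) := (tgeometry_consts 3 Ncb).2.1
  have hK₀c' : (tgeometry 3 Ncb).K₀ = K₀ (4 * 2 ^ 3) (2 * 3) := (tgeometry_consts 3 Ncb).2.2.1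
  have hrate' : r₁ + 2 * (tgeometry 3 Ncb).κ₀ + 2 ≤ R := by rw [hκ₀c]; exact hrate
  have hsmall' : Ag * Real.exp (5 * r₁ + 1) * (tgeometry 3 Ncb).K₀ * (tgeometry 3 Ncb).ν * (tgeometry 3 Ncb).c₁ ≤ 1 := by
    rw [hK₀c', hνc, hc₁c]; exact hsmall
  have hCE' : Real.exp 1 * (tgeometry 3 Ncb).ν * (tgeometry 3 Ncb).c₁ * (tgeometry 3 Ncb).K₀ ^ 2 * Ag = CE * Ag := by
    rw [hνc, hc₁c, hK₀c', hCE]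
  set cb : PBond (F.P J) 0 → TPt 3 Ncb := fun c => tcubeOf Ncb Mc (ecb c) with hcb
  set bs : Finset (TPt 3 Ncb) → Finset (PBond (F.P J) 0) := fun Y => Finset.univ.filter (fun c => cb c ∈ Y) with hbs
  set base : PBond (F.P K) 0 → (Fin 8 → ℂ) := fun e => if h : (D e).Nonempty then h.some else 0 with hbase
  set ext : (X : Finset (PBond (F.P J) 0)) → ({e : PBond (F.P K) 0 // blk e ∈ X} → (Fin 8 → ℂ)) → (PBond (F.P K) 0 → (Fin 8 → ℂ)) :=
    fun X p e => if h : blk e ∈ X then p ⟨e, h⟩ else base e with hext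
  set Eg : (PBond (F.P K) 0 → (Fin 8 → ℂ)) → Finset (TPt 3 Ncb) → ℂ :=
    fun q Y => locE TTouch (fun Z : TDom 3 Ncb => Z.1) (fun Z => act Z q) Y with hEg
  set wY : Finset (TPt 3 Ncb) → ℝ := fun Y => if TFaceConnected Y then W * Real.exp (-r₁ * torusTreeLen Y) else 0 with hwY
  have hwY0 : ∀ Y, 0 ≤ wY Y := by
    intro Y; simp only [hwY]; split_ifs
    · exact mul_nonneg hW0 (Real.exp_nonneg _)
    · exact le_rfl
  have hext_diff : ∀ X, Differentiable ℂ (ext X) := fun X => differentiable_cellExt blk X base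
  have hext_on : ∀ (X : Finset (PBond (F.P J) 0)) (p : {e : PBond (F.P K) 0 // blk e ∈ X} → (Fin 8 → ℂ)) (e : PBond (F.P K) 0)
      (h : blk e ∈ X), ext X p e = p ⟨e, h⟩ := by
    intro X p e h; simp only [hext, dif_pos h]
  have hopen : ∀ X : Finset (PBond (F.P J) 0), IsOpen {p : {e : PBond (F.P K) 0 // blk e ∈ X} → (Fin 8 → ℂ) | ∀ e, ext X p e ∈ D e} :=
    fun X => isOpen_cellDom blk X base D hDopen
  -- the parametrised activity field on the registers of the blocks of `X`, and the (I″) lemmas for it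
  have hhol' : ∀ X : Finset (PBond (F.P J) 0), ∀ Z : TDom 3 Ncb,
      DifferentiableOn ℂ (fun p => (fun p Z => act Z (ext X p)) p Z) {p | ∀ e, ext X p e ∈ D e} :=
    fun X Z => (hacthol Z).comp (hext_diff X).differentiableOn (fun p hp => hp)
  have hbd' : ∀ X : Finset (PBond (F.P J) 0), ∀ p ∈ {p : {e : PBond (F.P K) 0 // blk e ∈ X} → (Fin 8 → ℂ) | ∀ e, ext X p e ∈ D e},
      ∀ Z : TDom 3 Ncb, ‖(fun p Z => act Z (ext X p)) p Z‖ ≤ Ag * Real.exp (-(R * torusTreeLen Z.1)) :=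
    fun X p hp Z => hactbd Z (ext X p) hp
  refine ⟨c₀, d, blk, M,
    fun X p => ∑ Y ∈ Finset.univ.filter (fun Y => bs Y = X), (𝒮 Y (ext X p) + Eg (ext X p) Y),
    fun X => {p | ∀ e, ext X p e ∈ D e},
    fun X => ∑ Y ∈ Finset.univ.filter (fun Y => bs Y = X), wY Y,
    hd0, hdsymm, hdtri, hdC, hdκ, fun X => Finset.sum_nonneg fun Y _ => hwY0 Y, ?_, ?_, hopen, ?_, ?_, ?_, hr1, hr2, ?_⟩
  · -- one-pin sum: regroup by cube polymer, then (1.26) at the cube of `c`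
    intro c
    rw [Finset.sum_fiberwise_eq_sum_filter Finset.univ (Finset.univ.filter (fun X => c ∈ X)) bs wY]
    have hmem : ∀ Y, bs Y ∈ Finset.univ.filter (fun X => c ∈ X) ↔ cb c ∈ Y := by
      intro Y; simp only [Finset.mem_filter, Finset.mem_univ, true_and, hbs]
    have hpt : ∀ Y ∈ Finset.univ.filter (fun Y => bs Y ∈ Finset.univ.filter (fun X => c ∈ X)),
        wY Y ≤ if cb c ∈ Y ∧ TFaceConnected Y then W * Real.exp (-r₁ * torusTreeLen Y) else 0 := by
      intro Y hY
      have hcY : cb c ∈ Y := (hmem Y).mp (Finset.mem_filter.mp hY).2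
      by_cases hfc : TFaceConnected Y
      · rw [if_pos ⟨hcY, hfc⟩]; simp only [hwY, if_pos hfc, le_refl]
      · rw [if_neg (fun h => hfc h.2)]; simp only [hwY, if_neg hfc, le_refl]
    refine (Finset.sum_le_sum hpt).trans ?_
    rw [← Finset.sum_filter, Finset.filter_filter]
    have hfam : Finset.univ.filter (fun Y => bs Y ∈ Finset.univ.filter (fun X => c ∈ X) ∧ (cb c ∈ Y ∧ TFaceConnected Y))
        = Finset.univ.filter (fun Y => cb c ∈ Y ∧ TFaceConnected Y) := by
      refine Finset.filter_congr fun Y _ => ?_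
      rw [hmem Y]; tauto
    rw [hfam, ← Finset.mul_sum]
    have hκ1 : kappa₀ (4 * 2 ^ 3) (2 * 3) ≤ r₁ := by
      have h2 := hr₁κ
      set qκ : ℝ := kappa₀ (4 * 2 ^ 3) (2 * 3)
      linarith
    exact mul_le_mul_of_nonneg_left (sum_exp_torusTreeLen_le 3 Ncb (cb c) hκ1) hW0
  · -- two-pin sum: regroup, (1.26) at two marked cubes in site currency, then (d6)
    intro c c'
    rw [Finset.sum_fiberwise_eq_sum_filter Finset.univ (Finset.univ.filter (fun X => c ∈ X ∧ c' ∈ X)) bs wY]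
    have hmem : ∀ Y, bs Y ∈ Finset.univ.filter (fun X => c ∈ X ∧ c' ∈ X) ↔ cb c ∈ Y ∧ cb c' ∈ Y := by
      intro Y; simp only [Finset.mem_filter, Finset.mem_univ, true_and, hbs]
    have hpt : ∀ Y ∈ Finset.univ.filter (fun Y => bs Y ∈ Finset.univ.filter (fun X => c ∈ X ∧ c' ∈ X)),
        wY Y ≤ if cb c ∈ Y ∧ cb c' ∈ Y ∧ TFaceConnected Y then W * Real.exp (-r₁ * torusTreeLen Y) else 0 := by
      intro Y hY
      have hcY : cb c ∈ Y ∧ cb c' ∈ Y := (hmem Y).mp (Finset.mem_filter.mp hY).2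
      by_cases hfc : TFaceConnected Y
      · rw [if_pos ⟨hcY.1, hcY.2, hfc⟩]; simp only [hwY, if_pos hfc, le_refl]
      · rw [if_neg (fun h => hfc h.2.2)]; simp only [hwY, if_neg hfc, le_refl]
    refine (Finset.sum_le_sum hpt).trans ?_
    rw [← Finset.sum_filter, Finset.filter_filter]
    have hfam : Finset.univ.filter (fun Y => bs Y ∈ Finset.univ.filter (fun X => c ∈ X ∧ c' ∈ X) ∧ (cb c ∈ Y ∧ cb c' ∈ Y ∧ TFaceConnected Y))
        = Finset.univ.filter (fun Y => cb c ∈ Y ∧ cb c' ∈ Y ∧ TFaceConnected Y) := by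
      refine Finset.filter_congr fun Y _ => ?_
      rw [hmem Y]; tauto
    rw [hfam, ← Finset.mul_sum]
    have hκ2 : kappa₀ (4 * 2 ^ 3) (2 * 3) ≤ r₁ / 2 := by
      have h2 := hr₁κ
      set qκ : ℝ := kappa₀ (4 * 2 ^ 3) (2 * 3)
      linarith
    have htwo := sum_exp_torusTreeLen_two_sites_le 3 Ncb Mc (by norm_num) (ecb c) (ecb c') hκ2
    have hexp : Real.exp (-(r₁ / 2 / ((Mc : ℝ) * (3 : ℕ))) * pl1 (ecb c - ecb c')) ≤ Real.exp (-(2 * μ * d c c')) := by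
      refine Real.exp_le_exp.2 ?_
      have h6 := hd6 c c'
      have h3 : ((Mc : ℝ) * (3 : ℕ)) = (Mc : ℝ) * 3 := by push_cast; ring
      rw [h3]; linarith
    calc W * ∑ Y ∈ Finset.univ.filter (fun Y => cb c ∈ Y ∧ cb c' ∈ Y ∧ TFaceConnected Y), Real.exp (-r₁ * torusTreeLen Y)
        ≤ W * (Real.exp (3 * (r₁ / 2)) * Real.exp (-(r₁ / 2 / ((Mc : ℝ) * (3 : ℕ))) * pl1 (ecb c - ecb c')) * K₀ (4 * 2 ^ 3) (2 * 3)) :=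
          mul_le_mul_of_nonneg_left htwo hW0
      _ ≤ W * (Real.exp (3 * (r₁ / 2)) * Real.exp (-(2 * μ * d c c')) * K₀ (4 * 2 ^ 3) (2 * 3)) := by
          gcongr
      _ = W * Real.exp (3 * (r₁ / 2)) * K₀ (4 * 2 ^ 3) (2 * 3) * Real.exp (-(2 * μ * d c c')) := by ring
  · -- joint holomorphy on `Dom X`: finite sum of (analytic cube term ∘ glue) + (gas term, by (I″) at the register space of `X`'s blocks)
    intro X
    refine DifferentiableOn.fun_sum fun Y _ => DifferentiableOn.add ?_ ?_
    · exact (h𝒮hol Y).comp (hext_diff X).differentiableOn (fun p hp => hp)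
    · exact differentiableOn_locE_param_tthree (N := Ncb) (fun p Z => act Z (ext X p)) (hopen X) hAg hr₁0 hrate' hsmall'
        (hhol' X) (hbd' X) Y
  · -- the envelope `‖𝒯 X p‖ ≤ Bx X` on `Dom X`
    intro X p hp
    refine (norm_sum_le _ _).trans (Finset.sum_le_sum fun Y _ => ?_)
    by_cases hfc : TFaceConnected Y
    · simp only [hwY, if_pos hfc]
      refine (norm_add_le _ _).trans ?_
      have h1 : ‖𝒮 Y (ext X p)‖ ≤ As * Real.exp (-r₁ * torusTreeLen Y) := h𝒮bd Y (ext X p) hp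
      have h2 : ‖Eg (ext X p) Y‖ ≤ CE * Ag * Real.exp (-r₁ * torusTreeLen Y) := by
        have := norm_locE_param_le_tthree (N := Ncb) (fun p Z => act Z (ext X p)) (hopen X) hAg hr₁0 hrate' hsmall'
          (hhol' X) (hbd' X) Y hp
        rw [hCE'] at this
        exact this
      calc ‖𝒮 Y (ext X p)‖ + ‖Eg (ext X p) Y‖
          ≤ As * Real.exp (-r₁ * torusTreeLen Y) + CE * Ag * Real.exp (-r₁ * torusTreeLen Y) := add_le_add h1 h2
        _ = W * Real.exp (-r₁ * torusTreeLen Y) := by rw [hW]; ring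
    · simp only [hwY, if_neg hfc]
      have h1 : 𝒮 Y (ext X p) = 0 := h𝒮supp Y hfc _
      have h2 : Eg (ext X p) Y = 0 :=
        locE_param_eq_zero_of_not_tFaceConnected (N := Ncb) (fun p Z => act Z (ext X p)) hAg hr₁0 hrate' hsmall'
          (p := p) (fun Z => hbd' X p hp Z) hfc
      rw [h1, h2, add_zero, norm_zero]
  · -- the collar: the `2Rₐ`-ball about the real registers of a window field lies in `Dom X`
    intro X U hU p hp e
    by_cases h : blk e ∈ X
    · rw [hext_on X p e h]
      refine hcollar U hU e ?_
      rw [Metric.mem_ball] at hp ⊢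
      have hle := dist_le_pi_dist p (fun (e' : {e : PBond (F.P K) 0 // blk e ∈ X}) (i : Fin 8) => (M U e'.1 i : ℂ)) ⟨e, h⟩
      exact lt_of_le_of_lt hle hp
    · have hne : (D e).Nonempty := ⟨_, hcollar U hU e (Metric.mem_ball_self h2R)⟩
      have : ext X p e = hne.some := by simp only [hext, dif_neg h, hbase, dif_pos hne]
      rw [this]
      exact hne.some_mem
  · -- the representation: locality puts every term at the real registers `M U ↪ ℂ⁸`, fibrewise regrouping, and the last Mayer step at real activities
    intro U hU
    set q₀ : PBond (F.P K) 0 → (Fin 8 → ℂ) := fun e (i : Fin 8) => (M U e i : ℂ) with hq₀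
    have hq₀D : ∀ e, q₀ e ∈ D e := fun e => hcollar U hU e (Metric.mem_ball_self h2R)
    obtain ⟨-, -, hlog⟩ := locE_param_real (N := Ncb) (P := PBond (F.P K) 0 → (Fin 8 → ℂ)) (fun q Z => act Z q)
      hAg hr₁0 hrate' hsmall' (p := q₀) (fun Z => hactbd Z q₀ hq₀D) (hactreal U hU)
    have key : ∀ X : Finset (PBond (F.P J) 0), ∀ Y ∈ Finset.univ.filter (fun Y => bs Y = X),
        𝒮 Y (ext X (fun (e : {e : PBond (F.P K) 0 // blk e ∈ X}) (i : Fin 8) => (M U e.1 i : ℂ))) +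
            Eg (ext X (fun (e : {e : PBond (F.P K) 0 // blk e ∈ X}) (i : Fin 8) => (M U e.1 i : ℂ))) Y
          = 𝒮 Y q₀ + Eg q₀ Y := by
      intro X Y hY
      have hYX : bs Y = X := (Finset.mem_filter.mp hY).2
      have hagree : ∀ e, cb (blk e) ∈ Y →
          ext X (fun (e : {e : PBond (F.P K) 0 // blk e ∈ X}) (i : Fin 8) => (M U e.1 i : ℂ)) e = q₀ e := by
        intro e he
        have hbX : blk e ∈ X := by rw [← hYX]; exact Finset.mem_filter.mpr ⟨Finset.mem_univ _, he⟩
        exact hext_on X (fun (e' : {e : PBond (F.P K) 0 // blk e ∈ X}) (i : Fin 8) => (M U e'.1 i : ℂ)) e hbX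
      have hS : 𝒮 Y (ext X (fun (e : {e : PBond (F.P K) 0 // blk e ∈ X}) (i : Fin 8) => (M U e.1 i : ℂ))) = 𝒮 Y q₀ :=
        h𝒮loc Y _ _ hagree
      have hE : Eg (ext X (fun (e : {e : PBond (F.P K) 0 // blk e ∈ X}) (i : Fin 8) => (M U e.1 i : ℂ))) Y = Eg q₀ Y :=
        locE_congr TTouch fun Z hZ => hactloc Z _ _ fun e he => hagree e (hZ he)
      rw [hS, hE]
    rw [hrep U hU, hlog]
    have hsum : ∑ X : Finset (PBond (F.P J) 0), (∑ Y ∈ Finset.univ.filter (fun Y => bs Y = X),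
        (𝒮 Y (ext X (fun (e : {e : PBond (F.P K) 0 // blk e ∈ X}) (i : Fin 8) => (M U e.1 i : ℂ))) +
          Eg (ext X (fun (e : {e : PBond (F.P K) 0 // blk e ∈ X}) (i : Fin 8) => (M U e.1 i : ℂ))) Y)).re
        = ∑ Y : Finset (TPt 3 Ncb), ((𝒮 Y q₀).re + (Eg q₀ Y).re) := by
      rw [← Finset.sum_fiberwise Finset.univ bs (fun Y => (𝒮 Y q₀).re + (Eg q₀ Y).re)]
      refine Finset.sum_congr rfl fun X _ => ?_
      rw [Complex.re_sum]
      refine Finset.sum_congr rfl fun Y hY => ?_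
      rw [key X Y hY, Complex.add_re]
    rw [hsum, Finset.sum_add_distrib]
    ring

end Summit.QuantumFields.YangMills.Theorems.FluctuationComparisonRegPrIntLBackgroundFormCellGasKnit

end
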